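import Mathlib
import Literature.NumberTheory.LFunctions.Zhang2022.Section10Range1321MidTerm
import Literature.NumberTheory.LFunctions.Zhang2022.Section10Range1321MidScalars
import Literature.NumberTheory.LFunctions.Zhang2022.Section10Sj1321Outer
import HarnessLib

/-!
# Zhang (2022) §10, `Θ₁(𝐚₁₃,𝐚₂₁)`: the top range `P^{0.502} ≤ dr < P^{0.504}` — node
# `Z22:§10.u044` (first line) as a kernel EDGE from Lemmas 10.1 and 8.4

Topic `Literature/NumberTheory/LFunctions/Zhang2022` (Landau–Siegel audit tree; verdict-neutral).
Y. Zhang, *Discrete mean estimates and the Landau–Siegel zero*, arXiv:2211.02515v1 (2022)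
[Zhang2022LandauSiegel], §10 p. 58, tex L2989–L2993 — **an unrefereed manuscript under
adjudication; nothing here bears on its Theorems 1–2.**

> "By Lemma 10.1 and the results in Section 8, … the sum over `P^{0.502} < dr ≤ P^{0.504}` is
> equal to `(500L′(1,χ)²/(0.504 log²P)) Σ_{P^{0.502}≤n<P^{0.504}} |χ(n)|λ₀ⱼ(n)φ(n)⁻¹
> (1 − β_j log(P^{0.504}/n))𝔤_{j6}(P^{0.504}/n) + o(α)`"

**`eq1044a_of : Skeleton.Lemma101 c′ → Skeleton.Lemma84 c′ → Typed.Sec10B.Eq1044a c′`.** The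
deduction made explicit, on the pattern of the middle range (`Sj1321Mid.eq1043a_of`, sz-d33): the
`m`-sum is `𝔳₁ⱼ(dr)` (Lemma 10.1: (10.4) on `(P^{0.502}, P^{0.504}/T]`, (10.5) on the boundary point
`P^{0.502}` and on the `T`-window `(P^{0.504}/T, P^{0.504})`); the `n`-sum is `(log P₁)⁻¹ ×` Lemma
8.4's sum at `x = P₁/(dr)`, `μ = 6` — Lemma 8.4 (`T < x`) is available exactly for `dr < P₁/T`; on the
`T`-window `P₁/T ≤ dr < P₁` (`1 < x ≤ T`), which "the results in Section 8" do not reach, the crude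
bound `|Σ_{m<x}| ≤ log x·Σ_{m<x}|ξ₀ⱼ(m;d,r)|/m` and the tree's unconditional `ξ₀ⱼ`-tail mean
`XiZeroMajorant.xiZeroTailMean` (`≪ 𝓛(1 + log x)³`) are used against the `𝓛⁻⁷` of (10.5) — total
`≪ 𝓛^{−9.5} = o(α)` (`α = π𝓛⁻⁹`; the margin is `𝓛^{−1/2}`, bookkept with `√𝓛`); the `(d,r) ↦ n = dr`
collapse is (8.10) (`Sj1321Mid.sum_divisors_drWeight_mul_PiW`). Every constant is explicit in the
constants of Lemmas 10.1/8.4 and of the `ξ₀`-tail mean. Antecedents: the CLAIM nodes `Lemma101`,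
`Lemma84` (leaves of the cone); no named fact, no `def`.

## References

* Y. Zhang, arXiv:2211.02515v1 (2022), §10 p. 58; Lemma 10.1 (10.4)–(10.5); §8 Lemma 8.4, (8.10).
  [cite: Zhang2022LandauSiegel, §10 p. 58]
-/

noncomputable section

open Complex Real Finset ComplexConjugate

namespace Literature.NumberTheory.LFunctions.Zhang2022.Sj1321Top

open Skeleton Typed.Sec10B

variable (c' : ℝ) {D : ℕ}

/-! ## §1. Parameters and position facts of the top range -/

/-- `P > 0`. [cite: Zhang2022LandauSiegel, §2 (2.6)] -/
private theorem bigP_pos' (D : ℕ) : 0 < bigP D := Real.exp_pos _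

/-- `P > 1` once `𝓛 > 0`. [cite: Zhang2022LandauSiegel, §2 (2.6)] -/
private theorem one_lt_bigP (hL : 0 < ell D) : 1 < bigP D := by
  have h9 : 0 < ell D ^ 9 := by positivity
  have := Real.add_one_lt_exp h9.ne'
  rw [bigP]; linarith

/-- `log P = 𝓛⁹`. [cite: Zhang2022LandauSiegel, §2 (2.6)] -/
private theorem log_bigP' (D : ℕ) : Real.log (bigP D) = ell D ^ 9 := by rw [bigP, Real.log_exp]

/-- `log P₁ = 0.504 log P`. [cite: Zhang2022LandauSiegel, §2 (2.21)] -/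
private theorem log_P1' (D : ℕ) : Real.log (Skeleton.P1 D) = 0.504 * Real.log (bigP D) := by
  rw [Skeleton.P1, Real.log_rpow (bigP_pos' D)]

/-- `D ≥ ⌈e^M⌉₊ ⇒ 𝓛 ≥ M`. [folklore] -/
private theorem le_ell_of_ceil_exp_le' {M : ℝ} (hD : ⌈Real.exp M⌉₊ ≤ D) : M ≤ ell D := by
  have h1 : Real.exp M ≤ D := le_trans (Nat.le_ceil _) (by exact_mod_cast hD)
  rw [ell, ← Real.log_exp M]
  exact Real.log_le_log (Real.exp_pos M) h1

/-- **Strict** separation of the scales: `T·P^{0.502} < P^{0.504}` for `𝓛 ≥ 3` (so the boundary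
point `n = P^{0.502}` has `x = P₁/n = P^{0.002} > T`, and `P^{0.502} < P₁/T`).
[cite: Zhang2022LandauSiegel, §10 p. 58] -/
theorem bigT_mul_rpow_lt (hL : 3 ≤ ell D) :
    bigT D * bigP D ^ (0.502 : ℝ) < bigP D ^ (0.504 : ℝ) := by
  have hL1 : 1 ≤ ell D := by linarith
  have h7 : (3 : ℝ) ^ 7 ≤ ell D ^ 7 := pow_le_pow_left₀ (by norm_num) hL 7
  have hP0 : 0 < bigP D ^ (0.502 : ℝ) := Real.rpow_pos_of_pos (bigP_pos' D) _
  have h2 : 0 < ell D ^ 2 := by positivity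
  have e9 : ell D ^ 9 = ell D ^ 2 * ell D ^ 7 := by ring
  calc bigT D * bigP D ^ (0.502 : ℝ) ≤ Real.exp (ell D ^ 2) * bigP D ^ (0.502 : ℝ) := by
        have := Sj1321Mid.bigT_le_exp_sq (D := D) hL1
        gcongr
    _ = Real.exp (ell D ^ 2 + ell D ^ 9 * 0.502) := by
        rw [Sj1321Mid.bigP_rpow_eq, ← Real.exp_add]
    _ < Real.exp (ell D ^ 9 * 0.504) := by
        refine Real.exp_lt_exp.mpr ?_
        rw [e9]
        nlinarith [mul_le_mul_of_nonneg_left h7 h2.le]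
    _ = bigP D ^ (0.504 : ℝ) := (Sj1321Mid.bigP_rpow_eq D _).symm

/-- Position facts for `n` in the top range (`P^{0.502} ≤ n < P^{0.504}`, `𝓛 ≥ 3`): with
`x = P₁/n`, `1 ≤ x ≤ P^{0.004}`, `x < P`, `n < PT⁻²`, and `P^{0.5} ≤ n`.
[cite: Zhang2022LandauSiegel, §10 p. 58] -/
theorem topRange_facts (hL : 3 ≤ ell D) {n : ℕ} (hlo : bigP D ^ (0.502 : ℝ) ≤ (n : ℝ))
    (hhi : (n : ℝ) < bigP D ^ (0.504 : ℝ)) :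
    1 ≤ Skeleton.P1 D / (n : ℝ) ∧ Skeleton.P1 D / (n : ℝ) ≤ bigP D ^ (0.004 : ℝ) ∧
      Skeleton.P1 D / (n : ℝ) < bigP D ∧ (n : ℝ) < bigP D / bigT D ^ 2 ∧
      bigP D ^ (0.5 : ℝ) ≤ (n : ℝ) := by
  have hP : 0 < bigP D := bigP_pos' D
  have hP1 : 1 < bigP D := one_lt_bigP (by linarith)
  have hP2 : 0 < bigP D ^ (0.502 : ℝ) := Real.rpow_pos_of_pos hP _
  have hn : 0 < (n : ℝ) := lt_of_lt_of_le hP2 hlo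
  refine ⟨?_, ?_, ?_, ?_, ?_⟩
  · rw [le_div_iff₀ hn, one_mul, Skeleton.P1]; exact hhi.le
  · rw [div_le_iff₀ hn, Skeleton.P1]
    calc bigP D ^ (0.504 : ℝ) = bigP D ^ (0.002 : ℝ) * bigP D ^ (0.502 : ℝ) := by
          rw [← Real.rpow_add hP]; norm_num
      _ ≤ bigP D ^ (0.004 : ℝ) * n := by
          have h1 : bigP D ^ (0.002 : ℝ) ≤ bigP D ^ (0.004 : ℝ) :=
            Real.rpow_le_rpow_of_exponent_le hP1.le (by norm_num)
          have : 0 ≤ bigP D ^ (0.004 : ℝ) := Real.rpow_nonneg hP.le _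
          exact mul_le_mul h1 hlo hP2.le this
  · rw [div_lt_iff₀ hn, Skeleton.P1]
    have h1 : bigP D ^ (0.504 : ℝ) < bigP D := by
      conv_rhs => rw [← Real.rpow_one (bigP D)]
      exact Real.rpow_lt_rpow_of_exponent_lt hP1 (by norm_num)
    have hn1 : (1 : ℝ) ≤ n := by
      have : (1 : ℝ) ≤ bigP D ^ (0.502 : ℝ) := Real.one_le_rpow hP1.le (by norm_num)
      linarith
    nlinarith
  · calc (n : ℝ) < bigP D ^ (0.504 : ℝ) := hhi
      _ = Skeleton.P1 D := by rw [Skeleton.P1]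
      _ ≤ bigP D / bigT D ^ 2 := Sj1321Outer.P1_le_PT2 (by linarith)
  · exact le_trans (Real.rpow_le_rpow_of_exponent_le hP1.le (by norm_num)) hlo

/-! ## §2. The exact layer (index set and the collapse (8.10)) -/

/-- The index set of the top range: `{1 ≤ n < ⌈PT⁻²⌉ : P^{0.502} ≤ n < P^{0.504}}` is
`{1 ≤ n < ⌈P^{0.504}⌉ : P^{0.502} ≤ n}` (the set `Typed.Sec10B.nAvg` sums over).
[cite: Zhang2022LandauSiegel, §10 p. 58] -/
theorem filter_topRange_eq (hL : 3 ≤ ell D) :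
    (Finset.Ico 1 (Nsupp D)).filter
        (fun n : ℕ => bigP D ^ (0.502 : ℝ) ≤ (n : ℝ) ∧ (n : ℝ) < bigP D ^ (0.504 : ℝ)) =
      (Finset.Ico 1 ⌈bigP D ^ (0.504 : ℝ)⌉₊).filter (fun n : ℕ => bigP D ^ (0.502 : ℝ) ≤ (n : ℝ)) := by
  ext n
  simp only [Finset.mem_filter, Finset.mem_Ico]
  constructor
  · rintro ⟨⟨h1, _⟩, hlo, hhi⟩
    exact ⟨⟨h1, Nat.lt_ceil.mpr hhi⟩, hlo⟩
  · rintro ⟨⟨h1, h2⟩, hlo⟩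
    have hhi : (n : ℝ) < bigP D ^ (0.504 : ℝ) := Nat.lt_ceil.mp h2
    refine ⟨⟨h1, ?_⟩, hlo, hhi⟩
    have h := (topRange_facts hL hlo hhi).2.2.2.1
    rw [Nsupp]
    exact Nat.lt_ceil.mpr h

/-- **The exact layer of `Z22:§10.u044` (first line).** For a real `χ`, `𝓛 ≥ 3` and any `j`:
(the `(d,r)`-sum over `P^{0.502} ≤ dr < P^{0.504}`) − (the printed main term of `Eq1044a`) EQUALS the
weighted sum, over `n` in the range and `r ∣ n`, of the deviations
`mSum·nSum − m₁(n)·(L′(1,χ)Π(n/r,r)𝔤_{j6}(P₁/n)/log P₁)`, `m₁(n) = 500L′(1,χ)/log P·(1 − β_j log(P^{0.504}/n))`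
(the main values of Lemmas 10.1 (10.4) and 8.4). [cite: Zhang2022LandauSiegel, §10 p. 58] -/
theorem drSum_sub_main_eq_top [NeZero D] (χ : DirichletCharacter ℂ D) (hq : χ.IsQuadratic)
    (hL : 3 ≤ ell D) (j : ℕ) :
    drSum c' χ j (mSum13 c' χ j) (nSum21 c' χ j) (bigP D ^ (0.502 : ℝ)) (bigP D ^ (0.504 : ℝ)) -
        500 * deriv χ.LFunction 1 ^ 2 / (0.504 * logP D ^ 2) *
          nAvg c' χ j (bigP D ^ (0.502 : ℝ)) (bigP D ^ (0.504 : ℝ)) (fun n =>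
            (1 - betaJ c' D j * (Real.log (bigP D ^ (0.504 : ℝ) / n) : ℂ)) *
              frakgW c' D j 6 (bigP D ^ (0.504 : ℝ) / n)) =
      ∑ n ∈ (Finset.Ico 1 (Nsupp D)).filter
          (fun n : ℕ => bigP D ^ (0.502 : ℝ) ≤ (n : ℝ) ∧ (n : ℝ) < bigP D ^ (0.504 : ℝ)),
        ∑ r ∈ n.divisors, drWeight c' χ j (n / r) r *
          (mSum13 c' χ j n * nSum21 c' χ j (n / r) r -
            (500 * deriv χ.LFunction 1 / Real.log (bigP D) *
                (1 - betaJ c' D j * (Real.log (bigP D ^ (0.504 : ℝ) / n) : ℂ))) *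
              (deriv χ.LFunction 1 * PiW χ (n / r) r * frakgW c' D j 6 (Skeleton.P1 D / (n : ℝ)) /
                (Real.log (Skeleton.P1 D) : ℂ))) := by
  have hlogP : Real.log (bigP D) ≠ 0 := by
    rw [bigP, Real.log_exp]; have : 0 < ell D := by linarith
    positivity
  have hlogP1 : (Real.log (Skeleton.P1 D) : ℂ) ≠ 0 := by
    rw [log_P1']; push_cast
    exact mul_ne_zero (by norm_num) (by exact_mod_cast hlogP)
  -- the `(d,r)`-sum re-indexed
  rw [Sj1321Mid.drSum_eq_sum_divisors c' χ j _ _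
    (fun n hn => by
      have h := (topRange_facts hL hn.1 hn.2).2.2.2.1
      rw [Nsupp]; exact Nat.lt_ceil.mpr h)]
  -- the main term as the same double sum, via the collapse
  have hmain : nAvg c' χ j (bigP D ^ (0.502 : ℝ)) (bigP D ^ (0.504 : ℝ)) (fun n =>
        (1 - betaJ c' D j * (Real.log (bigP D ^ (0.504 : ℝ) / n) : ℂ)) *
          frakgW c' D j 6 (bigP D ^ (0.504 : ℝ) / n)) =
      ∑ n ∈ (Finset.Ico 1 (Nsupp D)).filter
          (fun n : ℕ => bigP D ^ (0.502 : ℝ) ≤ (n : ℝ) ∧ (n : ℝ) < bigP D ^ (0.504 : ℝ)),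
        ∑ r ∈ n.divisors, drWeight c' χ j (n / r) r * PiW χ (n / r) r *
          ((1 - betaJ c' D j * (Real.log (bigP D ^ (0.504 : ℝ) / n) : ℂ)) *
            frakgW c' D j 6 (bigP D ^ (0.504 : ℝ) / n)) := by
    rw [nAvg, ← filter_topRange_eq hL]
    refine Finset.sum_congr rfl fun n hn => ?_
    have hn0 : n ≠ 0 := by
      have := (Finset.mem_Ico.mp (Finset.mem_filter.mp hn).1).1; omega
    rw [Sj1321Mid.sum_divisors_drWeight_mul_PiW c' χ hq j hn0]
  rw [hmain, Finset.mul_sum, ← Finset.sum_sub_distrib]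
  refine Finset.sum_congr rfl fun n hn => ?_
  rw [Finset.mul_sum, ← Finset.sum_sub_distrib]
  refine Finset.sum_congr rfl fun r hr => ?_
  have hP1n : Skeleton.P1 D / (n : ℝ) = bigP D ^ (0.504 : ℝ) / n := by rw [Skeleton.P1]
  rw [hP1n, log_P1']
  push_cast
  field_simp

/-! ## §3. Sizes: the main value of (10.4), and the crude per-`n` estimate on the `T`-window -/

/-- `|500L′(1,χ)/log P·(1 − β_j log(P^{0.504}/y))| ≤ 1000|L′(1,χ)|𝓛⁻⁹` for
`P^{0.502} ≤ y ≤ P^{0.504}` (`|β_j| ≤ 4α`, `α·0.002 log P = 0.002π`), once `5|c′|α𝓛 ≤ 1`.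
[cite: Zhang2022LandauSiegel, §10 (10.4)] -/
theorem norm_mainV1top_le [NeZero D] (χ : DirichletCharacter ℂ D) (hL : 0 < ell D)
    (hc : 5 * |c'| * alpha D * ell D ≤ 1) (j : ℕ) {y : ℝ} (hlo : bigP D ^ (0.502 : ℝ) ≤ y)
    (hhi : y ≤ bigP D ^ (0.504 : ℝ)) :
    ‖500 * deriv χ.LFunction 1 / Real.log (bigP D) *
        (1 - betaJ c' D j * (Real.log (bigP D ^ (0.504 : ℝ) / y) : ℂ))‖ ≤
      1000 * ‖deriv χ.LFunction 1‖ / ell D ^ 9 := by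
  have hα : 0 < alpha D := by rw [alpha, bigP, Real.log_exp]; positivity
  have h9 : 0 < ell D ^ 9 := pow_pos hL 9
  have hP2 : 0 < bigP D ^ (0.502 : ℝ) := Real.rpow_pos_of_pos (Real.exp_pos _) _
  have hP4 : 0 < bigP D ^ (0.504 : ℝ) := Real.rpow_pos_of_pos (Real.exp_pos _) _
  have hy : 0 < y := lt_of_lt_of_le hP2 hlo
  have hlog0 : 0 ≤ Real.log (bigP D ^ (0.504 : ℝ) / y) :=
    Real.log_nonneg ((one_le_div hy).mpr hhi)
  have hlog1 : Real.log (bigP D ^ (0.504 : ℝ) / y) ≤ 0.002 * ell D ^ 9 := by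
    have h := Real.log_le_log hP2 hlo
    rw [Real.log_div hP4.ne' hy.ne']
    rw [Real.log_rpow (bigP_pos' D)] at h ⊢
    rw [bigP, Real.log_exp] at h ⊢
    linarith
  have hβ : ‖betaJ c' D j‖ ≤ 4 * alpha D :=
    Section8AbelProfiles.norm_betaJ_le c' hα.le hL.le hc j
  have hfac : ‖(1 : ℂ) - betaJ c' D j * (Real.log (bigP D ^ (0.504 : ℝ) / y) : ℂ)‖ ≤ 2 := by
    calc ‖(1 : ℂ) - betaJ c' D j * (Real.log (bigP D ^ (0.504 : ℝ) / y) : ℂ)‖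
        ≤ ‖(1 : ℂ)‖ + ‖betaJ c' D j * (Real.log (bigP D ^ (0.504 : ℝ) / y) : ℂ)‖ := norm_sub_le _ _
      _ = 1 + ‖betaJ c' D j‖ * Real.log (bigP D ^ (0.504 : ℝ) / y) := by
          rw [norm_one, norm_mul, Complex.norm_real, Real.norm_of_nonneg hlog0]
      _ ≤ 1 + 4 * alpha D * (0.002 * ell D ^ 9) := by gcongr
      _ = 1 + 0.008 * π := by rw [alpha, bigP, Real.log_exp]; field_simp; ring
      _ ≤ 2 := by nlinarith [Real.pi_lt_four]
  have hlogP : Real.log (bigP D) = ell D ^ 9 := by rw [bigP, Real.log_exp]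
  rw [norm_mul, norm_div, norm_mul, Complex.norm_real, hlogP, Real.norm_of_nonneg h9.le]
  have h500 : ‖(500 : ℂ)‖ = 500 := by norm_num
  rw [h500]
  calc 500 * ‖deriv χ.LFunction 1‖ / ell D ^ 9 *
        ‖(1 : ℂ) - betaJ c' D j * (Real.log (bigP D ^ (0.504 : ℝ) / y) : ℂ)‖
      ≤ 500 * ‖deriv χ.LFunction 1‖ / ell D ^ 9 * 2 := by gcongr
    _ = 1000 * ‖deriv χ.LFunction 1‖ / ell D ^ 9 := by ring

/-- **The per-`n` estimate WITHOUT Lemma 8.4** (for the `T`-window, where `x = P₁/n ≤ T`). Fix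
`n ≥ 1` and `j`. Suppose `|M| ≤ A′` (the `m`-sum), `|m₁| ≤ A`, `|g| ≤ 146`, `|L′(1,χ)| ≤ Λ′`, each
`n`-sum is `(log P₁)⁻¹S(r)` with the CRUDE bound `|S(r)| ≤ B`. Then
`|Σ_{r∣n} w(n/r,r)(M·(n-sum) − m₁·L′Π(n/r,r)g/log P₁)| ≤ (n/φ(n))⁷n⁻¹(A′B + 146AΛ′)/log P₁`
(`|w(n/r,r)| ≤ [r sqfree]φ(r)⁻¹(n/φ(n))⁴/n`, `|Π| ≤ (n/φ(n))²`, `Σ_{r∣n sqfree}φ(r)⁻¹ = n/φ(n)`).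
[cite: Zhang2022LandauSiegel, §10 p. 58] -/
theorem norm_sum_divisors_le_crude [NeZero D] (χ : DirichletCharacter ℂ D) (j : ℕ) {n : ℕ}
    (hn : n ≠ 0) (M m₁ g : ℂ) (S : ℕ → ℂ) {A' A B Λ' logP₁ : ℝ} (hB : 0 ≤ B) (hΛ : 0 ≤ Λ')
    (hlog : 0 < logP₁) (hM : ‖M‖ ≤ A') (hA : ‖m₁‖ ≤ A) (hg : ‖g‖ ≤ 146)
    (hL' : ‖deriv χ.LFunction 1‖ ≤ Λ')
    (hN : ∀ r ∈ n.divisors, nSum21 c' χ j (n / r) r = (1 / (logP₁ : ℂ)) * S r)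
    (hS : ∀ r ∈ n.divisors, ‖S r‖ ≤ B) :
    ‖∑ r ∈ n.divisors, drWeight c' χ j (n / r) r *
        (M * nSum21 c' χ j (n / r) r -
          m₁ * (deriv χ.LFunction 1 * PiW χ (n / r) r * g / (logP₁ : ℂ)))‖ ≤
      ((n : ℝ) / Nat.totient n) ^ 7 / n * ((A' * B + 146 * A * Λ') / logP₁) := by
  have a'0 : 0 ≤ A' := (norm_nonneg _).trans hM
  have a0 : 0 ≤ A := (norm_nonneg _).trans hA
  have hn0 : (0 : ℝ) < n := by exact_mod_cast Nat.pos_of_ne_zero hn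
  set ρ : ℝ := (n : ℝ) / Nat.totient n with hρ
  have hρ1 : 1 ≤ ρ := one_le_self_div_totient hn
  have hρ0 : 0 ≤ ρ := zero_le_one.trans hρ1
  set E : ℝ := A' * B + 146 * A * Λ' with hE
  have hE0 : 0 ≤ E := by positivity
  have hterm : ∀ r ∈ n.divisors,
      ‖drWeight c' χ j (n / r) r * (M * nSum21 c' χ j (n / r) r -
          m₁ * (deriv χ.LFunction 1 * PiW χ (n / r) r * g / (logP₁ : ℂ)))‖ ≤
        (if Squarefree r then 1 / (Nat.totient r : ℝ) else 0) * (ρ ^ 6 / n * (E / logP₁)) := by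
    intro r hr
    have hr0 : r ≠ 0 := (Nat.pos_of_mem_divisors hr).ne'
    have hd0 : n / r ≠ 0 := (Nat.div_pos (Nat.divisor_le hr) (Nat.pos_of_mem_divisors hr)).ne'
    have hrn : n / r * r = n := Nat.div_mul_cancel (Nat.dvd_of_mem_divisors hr)
    have hdev : M * nSum21 c' χ j (n / r) r -
        m₁ * (deriv χ.LFunction 1 * PiW χ (n / r) r * g / (logP₁ : ℂ)) =
        (1 / (logP₁ : ℂ)) * (M * S r - m₁ * (deriv χ.LFunction 1 * PiW χ (n / r) r * g)) := by
      rw [hN r hr]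
      have : (logP₁ : ℂ) ≠ 0 := by exact_mod_cast hlog.ne'
      field_simp
    have hPi : ‖PiW χ (n / r) r‖ ≤ ρ ^ 2 := by
      have h := norm_PiW_le χ hd0 hr0
      rwa [hrn] at h
    have hV : ‖m₁ * (deriv χ.LFunction 1 * PiW χ (n / r) r * g)‖ ≤ A * (Λ' * ρ ^ 2 * 146) := by
      rw [norm_mul, norm_mul, norm_mul]
      gcongr
    have hMS : ‖M * S r‖ ≤ A' * B := by
      rw [norm_mul]
      exact mul_le_mul hM (hS r hr) (norm_nonneg _) a'0
    have hprod : ‖M * S r - m₁ * (deriv χ.LFunction 1 * PiW χ (n / r) r * g)‖ ≤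
        A' * B + A * (Λ' * ρ ^ 2 * 146) := (norm_sub_le _ _).trans (add_le_add hMS hV)
    have hup : A' * B + A * (Λ' * ρ ^ 2 * 146) ≤ ρ ^ 2 * E := by
      have hρ2 : 1 ≤ ρ ^ 2 := one_le_pow₀ hρ1
      rw [hE]
      nlinarith [mul_nonneg a'0 hB, mul_nonneg a0 hΛ]
    have hw := Sj1321Mid.norm_drWeight_div_le c' χ j hn hr
    rw [hdev, norm_mul, norm_mul, norm_div, norm_one, Complex.norm_real,
      Real.norm_of_nonneg hlog.le]
    calc ‖drWeight c' χ j (n / r) r‖ *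
          (1 / logP₁ * ‖M * S r - m₁ * (deriv χ.LFunction 1 * PiW χ (n / r) r * g)‖)
        ≤ ((if Squarefree r then 1 / (Nat.totient r : ℝ) else 0) * (ρ ^ 4 / n)) *
            (1 / logP₁ * (ρ ^ 2 * E)) := by
          refine mul_le_mul hw ?_ (by positivity) ?_
          · exact mul_le_mul_of_nonneg_left (hprod.trans hup) (by positivity)
          · split_ifs <;> positivity
      _ = (if Squarefree r then 1 / (Nat.totient r : ℝ) else 0) * (ρ ^ 6 / n * (E / logP₁)) := by
          ring
  calc ‖∑ r ∈ n.divisors, drWeight c' χ j (n / r) r * (M * nSum21 c' χ j (n / r) r -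
          m₁ * (deriv χ.LFunction 1 * PiW χ (n / r) r * g / (logP₁ : ℂ)))‖
      ≤ ∑ r ∈ n.divisors, ‖drWeight c' χ j (n / r) r * (M * nSum21 c' χ j (n / r) r -
          m₁ * (deriv χ.LFunction 1 * PiW χ (n / r) r * g / (logP₁ : ℂ)))‖ := norm_sum_le _ _
    _ ≤ ∑ r ∈ n.divisors,
          (if Squarefree r then 1 / (Nat.totient r : ℝ) else 0) * (ρ ^ 6 / n * (E / logP₁)) :=
        Finset.sum_le_sum hterm
    _ = (∑ r ∈ n.divisors with Squarefree r, 1 / (Nat.totient r : ℝ)) * (ρ ^ 6 / n * (E / logP₁)) := by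
        rw [← Finset.sum_mul, Finset.sum_filter]
    _ = ρ ^ 7 / n * (E / logP₁) := by
        rw [sum_sqfree_divisors_inv_totient hn, ← hρ]; ring

/-! ## §4. Window weights `Σ (n/φ(n))⁷/n` over the pieces of the top range -/

/-- The good piece: `Σ_{⌊P^{0.502}⌋ < n ≤ ⌊P^{0.504}/T⌋} (n/φ(n))⁷/n ≤ e^{256}(2 + 𝓛⁹)` (`𝓛 ≥ 3`).
[cite: Zhang2022LandauSiegel, §10 p. 58] -/
theorem weight_good_top_le (hL : 3 ≤ ell D) :
    ∑ n ∈ Finset.Ioc ⌊bigP D ^ (0.502 : ℝ)⌋₊ ⌊bigP D ^ (0.504 : ℝ) / bigT D⌋₊,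
        ((n : ℝ) / Nat.totient n) ^ 7 / n ≤ Real.exp 256 * (2 + ell D ^ 9) := by
  have hT1 : 1 ≤ bigT D := Sj1321Mid.one_le_bigT D (by linarith)
  have hT0 : 0 < bigT D := by linarith
  have hP : 0 < bigP D := bigP_pos' D
  have hlo2 : (2 : ℝ) ≤ bigP D ^ (0.502 : ℝ) := by
    rw [Sj1321Mid.bigP_rpow_eq]
    have h9 : (3 : ℝ) ^ 9 ≤ ell D ^ 9 := pow_le_pow_left₀ (by norm_num) hL 9
    have : (1 : ℝ) ≤ ell D ^ 9 * 0.502 := by nlinarith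
    calc (2 : ℝ) ≤ 1 + 1 := by norm_num
      _ ≤ (ell D ^ 9 * 0.502) + 1 := by linarith
      _ ≤ Real.exp (ell D ^ 9 * 0.502) := Real.add_one_le_exp _
  have hhi : bigP D ^ (0.502 : ℝ) ≤ bigP D ^ (0.504 : ℝ) / bigT D := by
    rw [le_div_iff₀ hT0, mul_comm]; exact (bigT_mul_rpow_lt hL).le
  have hY : 0 < ⌊bigP D ^ (0.502 : ℝ)⌋₊ := Nat.floor_pos.mpr (by linarith)
  have hYX : ⌊bigP D ^ (0.502 : ℝ)⌋₊ ≤ ⌊bigP D ^ (0.504 : ℝ) / bigT D⌋₊ := Nat.floor_mono hhi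
  refine (sum_ratio_pow_div_le 7 hY hYX).trans ?_
  have hlogY : Real.log (bigP D ^ (0.502 : ℝ) / 2) ≤ Real.log (⌊bigP D ^ (0.502 : ℝ)⌋₊ : ℕ) := by
    refine Real.log_le_log (by linarith) ?_
    have := Nat.sub_one_lt_floor (bigP D ^ (0.502 : ℝ))
    linarith
  have hlogX : Real.log (⌊bigP D ^ (0.504 : ℝ) / bigT D⌋₊ : ℕ) ≤
      Real.log (bigP D ^ (0.504 : ℝ)) := by
    refine Real.log_le_log (by exact_mod_cast lt_of_lt_of_le hY hYX) ?_
    have hP4 : 0 ≤ bigP D ^ (0.504 : ℝ) := Real.rpow_nonneg hP.le _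
    exact (Nat.floor_le (div_nonneg hP4 hT0.le)).trans (div_le_self hP4 hT1)
  rw [Real.log_div (Real.rpow_pos_of_pos hP _).ne' (by norm_num),
    Real.log_rpow hP, log_bigP'] at hlogY
  rw [Real.log_rpow hP, log_bigP'] at hlogX
  have hlog2 : Real.log 2 ≤ 1 := by
    have := Real.log_two_lt_d9; linarith
  have h256 : (2 : ℝ) ^ (7 + 1) = 256 := by norm_num
  rw [h256]
  have h9 : 0 ≤ ell D ^ 9 := by positivity
  have hlin : 1 + Real.log (⌊bigP D ^ (0.504 : ℝ) / bigT D⌋₊ : ℕ) -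
      Real.log (⌊bigP D ^ (0.502 : ℝ)⌋₊ : ℕ) ≤ 2 + ell D ^ 9 := by linarith
  exact mul_le_mul_of_nonneg_left hlin (Real.exp_pos _).le

/-- The `T`-window: `Σ_{⌈P₁/T⌉ − 1 < n ≤ ⌈P₁⌉} (n/φ(n))⁷/n ≤ e^{256}(3 + log T)` (`𝓛 ≥ 3`).
[cite: Zhang2022LandauSiegel, §10 (10.5)] -/
theorem weight_tail_top_le (hL : 3 ≤ ell D) :
    ∑ n ∈ Finset.Ioc (⌈bigP D ^ (0.504 : ℝ) / bigT D⌉₊ - 1) ⌈bigP D ^ (0.504 : ℝ)⌉₊,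
        ((n : ℝ) / Nat.totient n) ^ 7 / n ≤ Real.exp 256 * (3 + Real.log (bigT D)) := by
  have hT1 : 1 ≤ bigT D := Sj1321Mid.one_le_bigT D (by linarith)
  have hT0 : 0 < bigT D := by linarith
  have hP : 0 < bigP D := bigP_pos' D
  have hP4 : 0 < bigP D ^ (0.504 : ℝ) := Real.rpow_pos_of_pos hP _
  have hlo2 : (2 : ℝ) ≤ bigP D ^ (0.502 : ℝ) := by
    rw [Sj1321Mid.bigP_rpow_eq]
    have h9 : (3 : ℝ) ^ 9 ≤ ell D ^ 9 := pow_le_pow_left₀ (by norm_num) hL 9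
    have : (1 : ℝ) ≤ ell D ^ 9 * 0.502 := by nlinarith
    calc (2 : ℝ) ≤ 1 + 1 := by norm_num
      _ ≤ (ell D ^ 9 * 0.502) + 1 := by linarith
      _ ≤ Real.exp (ell D ^ 9 * 0.502) := Real.add_one_le_exp _
  have hhi : bigP D ^ (0.502 : ℝ) ≤ bigP D ^ (0.504 : ℝ) / bigT D := by
    rw [le_div_iff₀ hT0, mul_comm]; exact (bigT_mul_rpow_lt hL).le
  set y : ℝ := bigP D ^ (0.504 : ℝ) / bigT D with hy
  have hy2 : (2 : ℝ) ≤ y := hlo2.trans hhi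
  set k : ℕ := ⌈y⌉₊ with hk
  have hk2 : 2 ≤ k := by
    have : (2 : ℝ) ≤ (k : ℝ) := hy2.trans (Nat.le_ceil _)
    exact_mod_cast this
  have hY : 0 < k - 1 := by omega
  have hkR : ((k - 1 : ℕ) : ℝ) = (k : ℝ) - 1 := by
    rw [Nat.cast_sub (by omega)]; norm_num
  have hYR : y / 2 ≤ ((k - 1 : ℕ) : ℝ) := by
    rw [hkR]
    have := Nat.le_ceil y
    rw [← hk] at this
    linarith
  have hYX : k - 1 ≤ ⌈bigP D ^ (0.504 : ℝ)⌉₊ := by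
    have h1 : k ≤ ⌈bigP D ^ (0.504 : ℝ)⌉₊ := Nat.ceil_mono (div_le_self hP4.le hT1)
    omega
  refine (sum_ratio_pow_div_le 7 hY hYX).trans ?_
  have hlogY : Real.log (y / 2) ≤ Real.log ((k - 1 : ℕ) : ℝ) :=
    Real.log_le_log (by linarith) hYR
  have hlogX : Real.log (⌈bigP D ^ (0.504 : ℝ)⌉₊ : ℕ) ≤ Real.log (2 * bigP D ^ (0.504 : ℝ)) := by
    refine Real.log_le_log (by exact_mod_cast lt_of_lt_of_le hY hYX) ?_
    have := Nat.ceil_lt_add_one hP4.le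
    have h1 : (1 : ℝ) ≤ bigP D ^ (0.504 : ℝ) := by
      have := hy2.trans (div_le_self hP4.le hT1); linarith
    linarith
  rw [hy, Real.log_div (div_pos hP4 hT0).ne' (by norm_num), Real.log_div hP4.ne' hT0.ne'] at hlogY
  rw [Real.log_mul (by norm_num) hP4.ne'] at hlogX
  have hlog2 : Real.log 2 ≤ 1 := by
    have := Real.log_two_lt_d9; linarith
  have h256 : (2 : ℝ) ^ (7 + 1) = 256 := by norm_num
  rw [h256]
  have hlin : 1 + Real.log (⌈bigP D ^ (0.504 : ℝ)⌉₊ : ℕ) - Real.log ((k - 1 : ℕ) : ℝ) ≤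
      3 + Real.log (bigT D) := by linarith
  exact mul_le_mul_of_nonneg_left hlin (Real.exp_pos _).le

/-! ## §5. Scalar bookkeeping (`L = 𝓛`, `s = √𝓛`, `t = log T = 𝓛^{1.1}`) -/

/-- The good term: `K_g𝓛⁻¹²/(0.504𝓛⁹)·e^{256}(2 + 𝓛⁹) ≤ 4e^{256}K_g/(s𝓛⁹)` (`1 ≤ s ≤ 𝓛`).
[cite: Zhang2022LandauSiegel, §10 p. 58] -/
theorem term_good_le {L s Kg : ℝ} (hL : 3 ≤ L) (hKg : 0 ≤ Kg) (hs1 : 1 ≤ s) (hsL : s ≤ L) :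
    Kg * (L ^ 12)⁻¹ / (0.504 * L ^ 9) * (Real.exp 256 * (2 + L ^ 9)) ≤
      4 * Real.exp 256 * Kg / (s * L ^ 9) := by
  have hL0 : 0 < L := by linarith
  have hs0 : 0 < s := by linarith
  have e0 : 0 < Real.exp 256 := Real.exp_pos _
  have heq : Kg * (L ^ 12)⁻¹ / (0.504 * L ^ 9) * (Real.exp 256 * (2 + L ^ 9)) =
      (Real.exp 256 * Kg) * ((2 + L ^ 9) / (0.504 * L ^ 9 * L ^ 12)) := by
    field_simp
  have heq' : 4 * Real.exp 256 * Kg / (s * L ^ 9) = (Real.exp 256 * Kg) * (4 / (s * L ^ 9)) := by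
    field_simp
  rw [heq, heq']
  refine mul_le_mul_of_nonneg_left ?_ (by positivity)
  rw [div_le_div_iff₀ (by positivity) (by positivity)]
  have h1 : s * L ^ 9 ≤ L * L ^ 9 := by gcongr
  have h2 : (2 + L ^ 9) * (L * L ^ 9) ≤ 4 * (0.504 * L ^ 9 * L ^ 12) := by
    have hL2 : 9 ≤ L ^ 2 := by nlinarith
    have e1 : (2 + L ^ 9) * (L * L ^ 9) = 2 * L ^ 10 + L ^ 19 := by ring
    have e2 : 4 * (0.504 * L ^ 9 * L ^ 12) = 2.016 * L ^ 21 := by ring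
    rw [e1, e2]
    have h10 : 0 < L ^ 10 := pow_pos hL0 10
    have : 2 * L ^ 10 ≤ L ^ 21 := by
      calc 2 * L ^ 10 ≤ L ^ 11 * L ^ 10 := by
            have h11 : 2 ≤ L ^ 11 := by
              have : (2 : ℝ) ≤ L := by linarith
              calc (2 : ℝ) = 2 ^ 1 := by norm_num
                _ ≤ L ^ 1 := by gcongr
                _ ≤ L ^ 11 := pow_le_pow_right₀ (by linarith) (by norm_num)
            nlinarith
        _ = L ^ 21 := by ring
    have : L ^ 19 ≤ L ^ 21 := pow_le_pow_right₀ (by linarith) (by norm_num)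
    nlinarith
  calc (2 + L ^ 9) * (s * L ^ 9) ≤ (2 + L ^ 9) * (L * L ^ 9) := by
        have : 0 ≤ 2 + L ^ 9 := by positivity
        exact mul_le_mul_of_nonneg_left h1 this
    _ ≤ 4 * (0.504 * L ^ 9 * L ^ 12) := h2

/-- The boundary-point term of Lemma-8.4 type: `K_e𝓛⁻³/(0.504𝓛⁹)·4e^{256} ≤ 8e^{256}K_e/(s𝓛⁹)`.
[cite: Zhang2022LandauSiegel, §10 p. 58] -/
theorem term_edge_le {L s Ke : ℝ} (hL : 3 ≤ L) (hKe : 0 ≤ Ke) (hs1 : 1 ≤ s) (hsL : s ≤ L) :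
    Ke * (L ^ 3)⁻¹ / (0.504 * L ^ 9) * (4 * Real.exp 256) ≤ 8 * Real.exp 256 * Ke / (s * L ^ 9) := by
  have hL0 : 0 < L := by linarith
  have hs0 : 0 < s := by linarith
  have e0 : 0 < Real.exp 256 := Real.exp_pos _
  have heq : Ke * (L ^ 3)⁻¹ / (0.504 * L ^ 9) * (4 * Real.exp 256) =
      (Real.exp 256 * Ke) * (4 / (0.504 * L ^ 9 * L ^ 3)) := by
    field_simp
  have heq' : 8 * Real.exp 256 * Ke / (s * L ^ 9) = (Real.exp 256 * Ke) * (8 / (s * L ^ 9)) := by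
    field_simp
  rw [heq, heq']
  refine mul_le_mul_of_nonneg_left ?_ (by positivity)
  rw [div_le_div_iff₀ (by positivity) (by positivity)]
  have hL3 : (3 : ℝ) ^ 3 ≤ L ^ 3 := pow_le_pow_left₀ (by norm_num) hL 3
  have h9 : 0 < L ^ 9 := pow_pos hL0 9
  have hL2 : 9 ≤ L ^ 2 := by nlinarith
  calc 4 * (s * L ^ 9) ≤ 4 * (L * L ^ 9) := by gcongr
    _ ≤ 8 * (0.504 * L ^ 9 * L ^ 3) := by
        have e1 : 8 * (0.504 * L ^ 9 * L ^ 3) = 4.032 * L ^ 2 * (L * L ^ 9) := by ring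
        rw [e1]
        have : 0 ≤ L * L ^ 9 := by positivity
        nlinarith

/-- The boundary-point term of crude type (`n = P₁/T`):
`B_p·4e^{256} ≤ e^{256}(64(|C₁|+1000)C_ξ + 1168000)/(s𝓛⁹)` (`t ≥ 1`, `t⁴ ≤ 𝓛⁴s`, `s² = 𝓛`).
[cite: Zhang2022LandauSiegel, §10 p. 58] -/
theorem term_point_le {L s t C₁ Cξ : ℝ} (hL : 3 ≤ L) (hs1 : 1 ≤ s) (hsL : s ≤ L) (hs2 : s ^ 2 = L)
    (ht1 : 1 ≤ t) (ht4 : t ^ 4 ≤ L ^ 4 * s) (hCξ : 0 ≤ Cξ) :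
    ((|C₁| * (L ^ 7)⁻¹ + 1000 * L ^ 3 / L ^ 9) * (t * (Cξ * L * (1 + t) ^ 3)) +
          146 * (1000 * L ^ 3 / L ^ 9) * L ^ 3) / (0.504 * L ^ 9) * (4 * Real.exp 256) ≤
      Real.exp 256 * (64 * (|C₁| + 1000) * Cξ + 1168000) / (s * L ^ 9) := by
  have hL0 : 0 < L := by linarith
  have hs0 : 0 < s := by linarith
  have ht0 : 0 < t := by linarith
  have e0 : 0 < Real.exp 256 := Real.exp_pos _
  have hC : 0 ≤ |C₁| := abs_nonneg _
  have h1 : (|C₁| * (L ^ 7)⁻¹ + 1000 * L ^ 3 / L ^ 9) ≤ (|C₁| + 1000) * (L ^ 6)⁻¹ := by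
    have h76 : (L ^ 7)⁻¹ ≤ (L ^ 6)⁻¹ :=
      inv_anti₀ (pow_pos hL0 6) (pow_le_pow_right₀ (by linarith) (by norm_num))
    have e1 : 1000 * L ^ 3 / L ^ 9 = 1000 * (L ^ 6)⁻¹ := by field_simp
    rw [e1]
    nlinarith [mul_le_mul_of_nonneg_left h76 hC]
  have h2 : t * (Cξ * L * (1 + t) ^ 3) ≤ 8 * Cξ * L ^ 5 * s := by
    have h1t : (1 + t) ^ 3 ≤ (2 * t) ^ 3 := by
      apply pow_le_pow_left₀ (by linarith) (by linarith)
    calc t * (Cξ * L * (1 + t) ^ 3) ≤ t * (Cξ * L * (2 * t) ^ 3) := by gcongr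
      _ = 8 * Cξ * L * t ^ 4 := by ring
      _ ≤ 8 * Cξ * L * (L ^ 4 * s) := by gcongr
      _ = 8 * Cξ * L ^ 5 * s := by ring
  have h3 : 146 * (1000 * L ^ 3 / L ^ 9) * L ^ 3 = 146000 * (L ^ 3)⁻¹ := by
    field_simp; norm_num
  have hnum : ((|C₁| * (L ^ 7)⁻¹ + 1000 * L ^ 3 / L ^ 9) * (t * (Cξ * L * (1 + t) ^ 3)) +
      146 * (1000 * L ^ 3 / L ^ 9) * L ^ 3) ≤
      (|C₁| + 1000) * (L ^ 6)⁻¹ * (8 * Cξ * L ^ 5 * s) + 146000 * (L ^ 3)⁻¹ := by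
    rw [h3]
    have ha : 0 ≤ |C₁| * (L ^ 7)⁻¹ + 1000 * L ^ 3 / L ^ 9 := by positivity
    have hb : 0 ≤ t * (Cξ * L * (1 + t) ^ 3) := by positivity
    nlinarith [mul_le_mul h1 h2 hb (by positivity)]
  have hsl : (L ^ 6)⁻¹ * (L ^ 5 * s) = s⁻¹ := by
    rw [← hs2]; field_simp
  have h3s : (L ^ 3)⁻¹ ≤ s⁻¹ := by
    apply inv_anti₀ hs0
    calc s ≤ L := hsL
      _ ≤ L ^ 3 := le_self_pow₀ (by linarith) (by norm_num)
  have hnum' : (|C₁| + 1000) * (L ^ 6)⁻¹ * (8 * Cξ * L ^ 5 * s) + 146000 * (L ^ 3)⁻¹ ≤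
      (8 * (|C₁| + 1000) * Cξ + 146000) * s⁻¹ := by
    have e1 : (|C₁| + 1000) * (L ^ 6)⁻¹ * (8 * Cξ * L ^ 5 * s) =
        8 * (|C₁| + 1000) * Cξ * ((L ^ 6)⁻¹ * (L ^ 5 * s)) := by ring
    rw [e1, hsl]
    nlinarith
  have hden : 0 < 0.504 * L ^ 9 := by positivity
  calc _ ≤ (8 * (|C₁| + 1000) * Cξ + 146000) * s⁻¹ / (0.504 * L ^ 9) * (4 * Real.exp 256) := by
        gcongr
        exact hnum.trans hnum'
    _ = Real.exp 256 * (32 * (|C₁| + 1000) * Cξ + 584000) / (0.504 * (s * L ^ 9)) := by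
        field_simp; ring
    _ ≤ Real.exp 256 * (64 * (|C₁| + 1000) * Cξ + 1168000) / (s * L ^ 9) := by
        rw [div_le_div_iff₀ (by positivity) (by positivity)]
        have hpos : 0 ≤ Real.exp 256 * (32 * (|C₁| + 1000) * Cξ + 584000) := by positivity
        have hsp : 0 < s * L ^ 9 := by positivity
        nlinarith [mul_nonneg hpos hsp.le]

/-- The `T`-window term: `B_t·e^{256}(3 + t) ≤ e^{256}(64|C₁|C_ξ + 1168000)/(s𝓛⁹)`
(`3 ≤ t ≤ 𝓛²`, `t⁵ ≤ 𝓛⁵s`, `s² = 𝓛`). [cite: Zhang2022LandauSiegel, §10 p. 58] -/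
theorem term_tail_le {L s t C₁ Cξ : ℝ} (hL : 3 ≤ L) (hs1 : 1 ≤ s) (hsL : s ≤ L) (hs2 : s ^ 2 = L)
    (ht3 : 3 ≤ t) (htL : t ≤ L ^ 2) (ht5 : t ^ 5 ≤ L ^ 5 * s) (hCξ : 0 ≤ Cξ) :
    (|C₁| * (L ^ 7)⁻¹ * (t * (Cξ * L * (1 + t) ^ 3)) + 146 * (1000 * L ^ 3 / L ^ 9) * L ^ 3) /
          (0.504 * L ^ 9) * (Real.exp 256 * (3 + t)) ≤
      Real.exp 256 * (64 * |C₁| * Cξ + 1168000) / (s * L ^ 9) := by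
  have hL0 : 0 < L := by linarith
  have hs0 : 0 < s := by linarith
  have ht0 : 0 < t := by linarith
  have e0 : 0 < Real.exp 256 := Real.exp_pos _
  have hC : 0 ≤ |C₁| := abs_nonneg _
  have h3 : 146 * (1000 * L ^ 3 / L ^ 9) * L ^ 3 = 146000 * (L ^ 3)⁻¹ := by
    field_simp; norm_num
  have h3t : 3 + t ≤ 2 * t := by linarith
  have hA : |C₁| * (L ^ 7)⁻¹ * (t * (Cξ * L * (1 + t) ^ 3)) * (2 * t) ≤ 32 * |C₁| * Cξ * s⁻¹ := by
    have h1t : (1 + t) ^ 3 ≤ (2 * t) ^ 3 := by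
      apply pow_le_pow_left₀ (by linarith) (by linarith)
    have hsl : (L ^ 7)⁻¹ * (L * (L ^ 5 * s)) = s⁻¹ := by
      rw [← hs2]; field_simp
    calc |C₁| * (L ^ 7)⁻¹ * (t * (Cξ * L * (1 + t) ^ 3)) * (2 * t)
        ≤ |C₁| * (L ^ 7)⁻¹ * (t * (Cξ * L * (2 * t) ^ 3)) * (2 * t) := by gcongr
      _ = 16 * |C₁| * Cξ * ((L ^ 7)⁻¹ * (L * t ^ 5)) := by ring
      _ ≤ 16 * |C₁| * Cξ * ((L ^ 7)⁻¹ * (L * (L ^ 5 * s))) := by gcongr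
      _ = 16 * |C₁| * Cξ * s⁻¹ := by rw [hsl]
      _ ≤ 32 * |C₁| * Cξ * s⁻¹ := by
          have : 0 ≤ |C₁| * Cξ * s⁻¹ := by positivity
          nlinarith
  have hB : 146000 * (L ^ 3)⁻¹ * (2 * t) ≤ 292000 * s⁻¹ := by
    have hsl : (L ^ 3)⁻¹ * L ^ 2 = L⁻¹ := by field_simp
    have hLs : L⁻¹ ≤ s⁻¹ := inv_anti₀ hs0 hsL
    calc 146000 * (L ^ 3)⁻¹ * (2 * t) ≤ 146000 * (L ^ 3)⁻¹ * (2 * L ^ 2) := by gcongr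
      _ = 292000 * ((L ^ 3)⁻¹ * L ^ 2) := by ring
      _ = 292000 * L⁻¹ := by rw [hsl]
      _ ≤ 292000 * s⁻¹ := by gcongr
  have hnum : (|C₁| * (L ^ 7)⁻¹ * (t * (Cξ * L * (1 + t) ^ 3)) + 146000 * (L ^ 3)⁻¹) * (3 + t) ≤
      (32 * |C₁| * Cξ + 292000) * s⁻¹ := by
    have hx : 0 ≤ |C₁| * (L ^ 7)⁻¹ * (t * (Cξ * L * (1 + t) ^ 3)) + 146000 * (L ^ 3)⁻¹ := by
      positivity
    calc _ ≤ (|C₁| * (L ^ 7)⁻¹ * (t * (Cξ * L * (1 + t) ^ 3)) + 146000 * (L ^ 3)⁻¹) * (2 * t) :=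
          mul_le_mul_of_nonneg_left h3t hx
      _ = |C₁| * (L ^ 7)⁻¹ * (t * (Cξ * L * (1 + t) ^ 3)) * (2 * t) +
            146000 * (L ^ 3)⁻¹ * (2 * t) := by ring
      _ ≤ 32 * |C₁| * Cξ * s⁻¹ + 292000 * s⁻¹ := add_le_add hA hB
      _ = (32 * |C₁| * Cξ + 292000) * s⁻¹ := by ring
  rw [h3]
  calc (|C₁| * (L ^ 7)⁻¹ * (t * (Cξ * L * (1 + t) ^ 3)) + 146000 * (L ^ 3)⁻¹) / (0.504 * L ^ 9) *
          (Real.exp 256 * (3 + t))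
        = Real.exp 256 * (((|C₁| * (L ^ 7)⁻¹ * (t * (Cξ * L * (1 + t) ^ 3)) +
            146000 * (L ^ 3)⁻¹) * (3 + t)) / (0.504 * L ^ 9)) := by ring
    _ ≤ Real.exp 256 * (((32 * |C₁| * Cξ + 292000) * s⁻¹) / (0.504 * L ^ 9)) := by
        gcongr
    _ = Real.exp 256 * (32 * |C₁| * Cξ + 292000) / (0.504 * (s * L ^ 9)) := by
        field_simp
    _ ≤ Real.exp 256 * (64 * |C₁| * Cξ + 1168000) / (s * L ^ 9) := by
        rw [div_le_div_iff₀ (by positivity) (by positivity)]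
        have hpos : 0 ≤ Real.exp 256 * (32 * |C₁| * Cξ + 292000) := by positivity
        have hsp : 0 < s * L ^ 9 := by positivity
        have hmono : Real.exp 256 * (32 * |C₁| * Cξ + 292000) ≤
            Real.exp 256 * (64 * |C₁| * Cξ + 1168000) := by
          gcongr <;> nlinarith [mul_nonneg hC hCξ]
        nlinarith [mul_nonneg hpos hsp.le, mul_le_mul_of_nonneg_right hmono hsp.le]

/-- The threshold: `e^{256}K/(s𝓛⁹) ≤ επ/𝓛⁹` once `e^{256}K/(επ) ≤ s`.
[cite: Zhang2022LandauSiegel, §10 p. 58] -/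
theorem threshold_le {L s K ε : ℝ} (hL : 0 < L) (hs : 0 < s) (hε : 0 < ε)
    (hth : Real.exp 256 * K / (ε * π) ≤ s) :
    Real.exp 256 * K / (s * L ^ 9) ≤ ε * (π / L ^ 9) := by
  have hεπ : 0 < ε * π := mul_pos hε Real.pi_pos
  have h1 : Real.exp 256 * K ≤ s * (ε * π) := by
    have := (div_le_iff₀ hεπ).mp hth
    linarith
  rw [div_le_iff₀ (by positivity)]
  have e1 : ε * (π / L ^ 9) * (s * L ^ 9) = s * (ε * π) := by field_simp
  rw [e1]
  exact h1

/-- `t = 𝓛^{1.1}` against `𝓛` and `s = √𝓛`: `t⁵ ≤ 𝓛⁵s`, `t⁴ ≤ 𝓛⁴s`, `𝓛 ≤ t ≤ 𝓛²`, `s² = 𝓛`,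
`1 ≤ s ≤ 𝓛` (for `𝓛 ≥ 1`). [cite: Zhang2022LandauSiegel, §6 p. 30] -/
theorem rpow11_facts {L : ℝ} (hL : 1 ≤ L) :
    (L ^ (1.1 : ℝ)) ^ 5 ≤ L ^ 5 * Real.sqrt L ∧ (L ^ (1.1 : ℝ)) ^ 4 ≤ L ^ 4 * Real.sqrt L ∧
      L ≤ L ^ (1.1 : ℝ) ∧ L ^ (1.1 : ℝ) ≤ L ^ 2 ∧ Real.sqrt L ^ 2 = L ∧ 1 ≤ Real.sqrt L ∧
      Real.sqrt L ≤ L := by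
  have hL0 : 0 ≤ L := by linarith
  have hs : Real.sqrt L = L ^ (1 / 2 : ℝ) := Real.sqrt_eq_rpow L
  refine ⟨?_, ?_, ?_, ?_, ?_, ?_, ?_⟩
  · have e1 : (L ^ (1.1 : ℝ)) ^ 5 = L ^ (5.5 : ℝ) := by
      rw [← Real.rpow_natCast, ← Real.rpow_mul hL0]; norm_num
    have e2 : L ^ 5 * Real.sqrt L = L ^ (5.5 : ℝ) := by
      rw [hs, ← Real.rpow_natCast, ← Real.rpow_add (by linarith)]; norm_num
    rw [e1, e2]
  · have e1 : (L ^ (1.1 : ℝ)) ^ 4 = L ^ (4.4 : ℝ) := by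
      rw [← Real.rpow_natCast, ← Real.rpow_mul hL0]; norm_num
    have e2 : L ^ 4 * Real.sqrt L = L ^ (4.5 : ℝ) := by
      rw [hs, ← Real.rpow_natCast, ← Real.rpow_add (by linarith)]; norm_num
    rw [e1, e2]
    exact Real.rpow_le_rpow_of_exponent_le hL (by norm_num)
  · conv_lhs => rw [← Real.rpow_one L]
    exact Real.rpow_le_rpow_of_exponent_le hL (by norm_num)
  · have h := Real.rpow_le_rpow_of_exponent_le hL (show (1.1 : ℝ) ≤ 2 by norm_num)
    rwa [Real.rpow_two] at h
  · exact Real.sq_sqrt hL0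
  · rw [show (1 : ℝ) = Real.sqrt 1 by simp]
    exact Real.sqrt_le_sqrt hL
  · rw [hs]
    conv_rhs => rw [← Real.rpow_one L]
    exact Real.rpow_le_rpow_of_exponent_le hL (by norm_num)

/-! ## §6. The edge `Lemma101 → Lemma84 → Eq1044a` -/

set_option maxHeartbeats 400000 in
-- one long bookkeeping proof (three position classes of `n`): a modest heartbeat margin
/-- **`Z22:§10.u044` (first line) from Lemmas 10.1 and 8.4**: the top-range evaluation
`Typed.Sec10B.Eq1044a c′` holds whenever the CLAIM nodes `Skeleton.Lemma101 c′` (Lemma 10.1) and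
`Skeleton.Lemma84 c′` (Lemma 8.4) hold — the manuscript's "By Lemma 10.1 and the results in
Section 8" for the range `P^{0.502} ≤ dr < P^{0.504}`, with every implicit estimate made explicit:
good range `P^{0.502} < n < P₁/T` ((10.4) × Lemma 8.4), boundary point `n = P^{0.502}` ((10.5) × Lemma
8.4), the point `n = P₁/T` ((10.4) × crude `ξ₀`-tail bound) and the `T`-window `P₁/T < n < P₁`
((10.5) × crude `ξ₀`-tail bound, `XiZeroMajorant.xiZeroTailMean`); total
`≤ e^{256}K/(√𝓛·𝓛⁹) ≤ εα` for `√𝓛 ≥ e^{256}K/(επ)`, `K` explicit in the constants of Lemma 10.1,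
Lemma 8.4 and the `ξ₀`-tail mean. [cite: Zhang2022LandauSiegel, §10 p. 58] -/
theorem eq1044a_of (c' : ℝ) (h101 : Lemma101 c') (h84 : Lemma84 c') : Eq1044a c' := by
  obtain ⟨c₁, -, C₁, D₁, h₁⟩ := h101
  obtain ⟨C₂, D₂, h₂⟩ := h84
  obtain ⟨Cξ, Dξ, hξ⟩ := XiZeroMajorant.xiZeroTailMean c'
  intro ε hε
  -- constants
  set Cξp : ℝ := max Cξ 0 with hCξp
  have hCξ0 : 0 ≤ Cξp := le_max_right _ _
  set Kg : ℝ := |C₁| * (|C₂| + 146) + 1000 * |C₂| with hKg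
  set Ke : ℝ := (|C₁| + 1000) * (|C₂| + 146) + 1000 * |C₂| with hKe
  have hKg0 : 0 ≤ Kg := by positivity
  have hKe0 : 0 ≤ Ke := by positivity
  set K : ℝ := 4 * Kg + 8 * Ke + (64 * (|C₁| + 1000) * Cξp + 1168000) +
    (64 * |C₁| * Cξp + 1168000) with hK
  have hK0 : 0 ≤ K := by positivity
  set L₀ : ℝ := max 200 (max (5 * π * |c'| + 1) ((Real.exp 256 * K / (ε * π)) ^ 2))
    with hL₀
  refine ⟨max (max D₁ D₂) (max Dξ ⌈Real.exp L₀⌉₊), fun D _ χ hD hq hp hA j hj => ?_⟩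
  -- thresholds
  have hD₁ : D₁ ≤ D := le_trans (le_trans (le_max_left _ _) (le_max_left _ _)) hD
  have hD₂ : D₂ ≤ D := le_trans (le_trans (le_max_right _ _) (le_max_left _ _)) hD
  have hDξ : Dξ ≤ D := le_trans (le_trans (le_max_left _ _) (le_max_right _ _)) hD
  have hL : L₀ ≤ ell D :=
    le_ell_of_ceil_exp_le' (le_trans (le_trans (le_max_right _ _) (le_max_right _ _)) hD)
  have hL200 : 200 ≤ ell D := le_trans (le_max_left _ _) hL
  have hLc : 5 * π * |c'| + 1 ≤ ell D :=
    le_trans (le_trans (le_max_left _ _) (le_max_right _ _)) hL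
  have hLK : (Real.exp 256 * K / (ε * π)) ^ 2 ≤ ell D :=
    le_trans (le_trans (le_max_right _ _) (le_max_right _ _)) hL
  have hL3 : 3 ≤ ell D := by linarith
  have hLpos : 0 < ell D := by linarith
  have hL1 : 1 ≤ ell D := by linarith
  -- `s = √𝓛`, `t = log T = 𝓛^{1.1}`
  obtain ⟨ht5, ht4, hLt, htL2, hs2, hs1, hsL⟩ := rpow11_facts hL1
  set s : ℝ := Real.sqrt (ell D) with hs
  set t : ℝ := ell D ^ (1.1 : ℝ) with ht
  have hs0 : 0 < s := by linarith
  have ht3 : 3 ≤ t := le_trans hL3 hLt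
  have ht1 : 1 ≤ t := by linarith
  have hlogT : Real.log (bigT D) = t := by rw [ht, Skeleton.bigT, Real.log_exp]
  have hth : Real.exp 256 * K / (ε * π) ≤ s := by
    have h0 : 0 ≤ Real.exp 256 * K / (ε * π) := by positivity
    rw [hs, ← Real.sqrt_sq h0]
    exact Real.sqrt_le_sqrt hLK
  -- `α = π𝓛⁻⁹` and the `c′`-condition of the `β`-bounds
  have hα : alpha D = π / ell D ^ 9 := by rw [alpha, bigP, Real.log_exp]
  have hc : 5 * |c'| * alpha D * ell D ≤ 1 := by
    rw [hα]
    have h8 : ell D ≤ ell D ^ 8 := le_self_pow₀ hL1 (by norm_num)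
    have h1 : 5 * |c'| * (π / ell D ^ 9) * ell D = 5 * π * |c'| / ell D ^ 8 := by
      field_simp
    rw [h1, div_le_one (by positivity)]
    nlinarith [Real.pi_pos, abs_nonneg c']
  -- the two lemmas and the tail mean at this `D, χ, j`
  have h₁' := h₁ D χ hD₁ hq hp hA j hj
  have h₂' := h₂ D χ hD₂ hq hp hA j hj 6 (by simp)
  have hξ' : ∀ d r : ℕ, 1 ≤ d → 1 ≤ r → ((d * r : ℕ) : ℝ) < Skeleton.P1 D → ∀ x : ℝ, 1 ≤ x →
      x ≤ bigT D → ∑ n ∈ Ico 1 ⌈x⌉₊, ‖xiZero c' D j n d r‖ / n ≤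
        Cξp * ell D * (1 + Real.log x) ^ 3 := fun d r hd hr hdr x hx1 hx2 => by
    have hlog : 0 ≤ 1 + Real.log x := by
      have := Real.log_nonneg hx1; linarith
    exact (hξ D χ hDξ hq hp j hj d r hd hr hdr x hx1 hx2).trans
      (mul_le_mul_of_nonneg_right (mul_le_mul_of_nonneg_right (le_max_left _ _) hLpos.le)
        (by positivity))
  have hL' : ‖deriv χ.LFunction 1‖ ≤ ell D ^ 3 := Sj1321Mid.norm_derivL_one_le_cube χ hp hL200
  -- positivity of the basic parameters
  have hP : 0 < bigP D := bigP_pos' D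
  have hP2 : 0 < bigP D ^ (0.502 : ℝ) := Real.rpow_pos_of_pos hP _
  have hP4 : 0 < bigP D ^ (0.504 : ℝ) := Real.rpow_pos_of_pos hP _
  have hT1 : 1 < bigT D := by
    have h11 : 0 < ell D ^ (1.1 : ℝ) := Real.rpow_pos_of_pos hLpos _
    have := Real.add_one_lt_exp h11.ne'
    rw [Skeleton.bigT]; linarith
  have hT0 : 0 < bigT D := by linarith
  have hlP1 : Real.log (Skeleton.P1 D) = 0.504 * ell D ^ 9 := by
    rw [Skeleton.P1, Real.log_rpow hP, bigP, Real.log_exp]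
  have hlP1pos : 0 < Real.log (Skeleton.P1 D) := by rw [hlP1]; positivity
  have hP1eq : Skeleton.P1 D = bigP D ^ (0.504 : ℝ) := by rw [Skeleton.P1]
  have hTP : bigT D * bigP D ^ (0.502 : ℝ) < bigP D ^ (0.504 : ℝ) := bigT_mul_rpow_lt hL3
  -- the exact layer
  rw [drSum_sub_main_eq_top c' χ hq hL3 j]
  -- abbreviations
  set e₂ : ℝ := |C₂| * (ell D ^ 6)⁻¹ with he₂
  set A : ℝ := 1000 * ell D ^ 3 / ell D ^ 9 with hAdef
  set Bξ : ℝ := t * (Cξp * ell D * (1 + t) ^ 3) with hBξ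
  set Bg : ℝ := (|C₁| * (ell D ^ 15)⁻¹ * (e₂ + 146 * ell D ^ 3) + A * e₂) /
    Real.log (Skeleton.P1 D) with hBg
  set Be : ℝ := ((|C₁| * (ell D ^ 7)⁻¹ + A) * (e₂ + 146 * ell D ^ 3) + A * e₂) /
    Real.log (Skeleton.P1 D) with hBe
  set Bp : ℝ := ((|C₁| * (ell D ^ 7)⁻¹ + A) * Bξ + 146 * A * ell D ^ 3) /
    Real.log (Skeleton.P1 D) with hBp
  set Bt : ℝ := (|C₁| * (ell D ^ 7)⁻¹ * Bξ + 146 * A * ell D ^ 3) /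
    Real.log (Skeleton.P1 D) with hBt
  have he₂0 : 0 ≤ e₂ := by positivity
  have hA0 : 0 ≤ A := by positivity
  have hBξ0 : 0 ≤ Bξ := by positivity
  have hBg0 : 0 ≤ Bg := by positivity
  have hBe0 : 0 ≤ Be := by positivity
  have hBp0 : 0 ≤ Bp := by positivity
  have hBt0 : 0 ≤ Bt := by positivity
  set good : ℕ → Prop := fun n => bigP D ^ (0.502 : ℝ) < (n : ℝ) ∧
    bigT D * (n : ℝ) < bigP D ^ (0.504 : ℝ) with hgood
  set tail : ℕ → Prop := fun n => bigP D ^ (0.504 : ℝ) < bigT D * (n : ℝ) with htail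
  set S := (Finset.Ico 1 (Nsupp D)).filter
      (fun n : ℕ => bigP D ^ (0.502 : ℝ) ≤ (n : ℝ) ∧ (n : ℝ) < bigP D ^ (0.504 : ℝ)) with hSdef
  -- **the per-`n` bound**
  have key : ∀ n ∈ S,
      ‖∑ r ∈ n.divisors, drWeight c' χ j (n / r) r *
          (mSum13 c' χ j n * nSum21 c' χ j (n / r) r -
            (500 * deriv χ.LFunction 1 / Real.log (bigP D) *
                (1 - betaJ c' D j * (Real.log (bigP D ^ (0.504 : ℝ) / n) : ℂ))) *
              (deriv χ.LFunction 1 * PiW χ (n / r) r *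
                frakgW c' D j 6 (Skeleton.P1 D / (n : ℝ)) / (Real.log (Skeleton.P1 D) : ℂ)))‖ ≤
        Bg * (if good n then ((n : ℝ) / Nat.totient n) ^ 7 / n else 0) +
          Bt * (if ¬ good n ∧ tail n then ((n : ℝ) / Nat.totient n) ^ 7 / n else 0) +
          (Be + Bp) * (if ¬ good n ∧ ¬ tail n then ((n : ℝ) / Nat.totient n) ^ 7 / n else 0) := by
    intro n hn
    rw [hSdef, Finset.mem_filter, Finset.mem_Ico] at hn
    obtain ⟨⟨hn1, -⟩, hlo, hhi⟩ := hn
    have hn0 : n ≠ 0 := by omega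
    have hnpos : (0 : ℝ) < n := by exact_mod_cast Nat.pos_of_ne_zero hn0
    obtain ⟨hx1, hx4, hxP, hnT, hlo5⟩ := topRange_facts hL3 hlo hhi
    have hw0 : 0 ≤ ((n : ℝ) / Nat.totient n) ^ 7 / n := by positivity
    -- sizes of the main values
    have hg : ‖frakgW c' D j 6 (Skeleton.P1 D / (n : ℝ))‖ ≤ 146 :=
      Sj1321Mid.norm_frakgW_six_le c' hLpos hc j hx1 hx4
    have hm₁ : ‖500 * deriv χ.LFunction 1 / Real.log (bigP D) *
        (1 - betaJ c' D j * (Real.log (bigP D ^ (0.504 : ℝ) / n) : ℂ))‖ ≤ A := by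
      refine (norm_mainV1top_le c' χ hLpos hc j hlo hhi.le).trans ?_
      rw [hAdef]
      gcongr
    -- the `n`-sums in Lemma 8.4's shape at `x = P₁/n`, `(d, r) = (n/r, r)`
    have hN : ∀ r ∈ n.divisors, nSum21 c' χ j (n / r) r =
        (1 / (Real.log (Skeleton.P1 D) : ℂ)) *
          ∑ m ∈ Finset.Ico 1 ⌈Skeleton.P1 D / (n : ℝ)⌉₊,
            χ (m : ZMod D) * xiZero c' D j m (n / r) r / (m : ℂ) *
              (((Skeleton.P1 D / (n : ℝ)) / m : ℝ) : ℂ) ^ (-betaMu D 6) *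
              (Real.log ((Skeleton.P1 D / (n : ℝ)) / m) : ℂ) := by
      intro r hr
      have hrn : n / r * r = n := Nat.div_mul_cancel (Nat.dvd_of_mem_divisors hr)
      have hd1 : 1 ≤ n / r := Nat.div_pos (Nat.divisor_le hr) (Nat.pos_of_mem_divisors hr)
      have hr1 : 1 ≤ r := Nat.pos_of_mem_divisors hr
      have hlo' : bigP D ^ (0.5 : ℝ) ≤ ((n / r * r : ℕ) : ℝ) := by rw [hrn]; exact hlo5
      have h := Sj1321Mid.nSum21_eq c' χ hL3 j hd1 hr1 hlo'
      rw [hrn] at h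
      exact h
    -- the `m`-sum is `𝔳₁ⱼ(n)`
    have hMv : mSum13 c' χ j n = frakv1 c' χ j (n : ℝ) := Sj1321Mid.mSum13_eq_frakv1 c' χ hL3 j hlo5
    -- Lemma 8.4 is available when `T < x`, i.e. `T·n < P₁`
    have h2 : bigT D * (n : ℝ) < bigP D ^ (0.504 : ℝ) → ∀ r ∈ n.divisors,
        ‖(∑ m ∈ Finset.Ico 1 ⌈Skeleton.P1 D / (n : ℝ)⌉₊,
            χ (m : ZMod D) * xiZero c' D j m (n / r) r / (m : ℂ) *
              (((Skeleton.P1 D / (n : ℝ)) / m : ℝ) : ℂ) ^ (-betaMu D 6) *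
              (Real.log ((Skeleton.P1 D / (n : ℝ)) / m) : ℂ)) -
          deriv χ.LFunction 1 * PiW χ (n / r) r * frakgW c' D j 6 (Skeleton.P1 D / (n : ℝ))‖
          ≤ e₂ := by
      intro hTn r hr
      have hrn : n / r * r = n := Nat.div_mul_cancel (Nat.dvd_of_mem_divisors hr)
      have hd1 : 1 ≤ n / r := Nat.div_pos (Nat.divisor_le hr) (Nat.pos_of_mem_divisors hr)
      have hr1 : 1 ≤ r := Nat.pos_of_mem_divisors hr
      have hdrT : ((n / r * r : ℕ) : ℝ) < bigP D / bigT D ^ 2 := by rw [hrn]; exact hnT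
      have hTx : bigT D < Skeleton.P1 D / (n : ℝ) := by
        rw [lt_div_iff₀ hnpos, hP1eq]; exact hTn
      have h := h₂' (n / r) r hd1 hr1 hdrT (Skeleton.P1 D / (n : ℝ)) hTx hxP
      refine h.trans ?_
      rw [he₂]
      exact mul_le_mul_of_nonneg_right (le_abs_self _) (by positivity)
    -- the crude bound is available when `x ≤ T`, i.e. `P₁ ≤ T·n`
    have hS : bigP D ^ (0.504 : ℝ) ≤ bigT D * (n : ℝ) → ∀ r ∈ n.divisors,
        ‖∑ m ∈ Finset.Ico 1 ⌈Skeleton.P1 D / (n : ℝ)⌉₊,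
            χ (m : ZMod D) * xiZero c' D j m (n / r) r / (m : ℂ) *
              (((Skeleton.P1 D / (n : ℝ)) / m : ℝ) : ℂ) ^ (-betaMu D 6) *
              (Real.log ((Skeleton.P1 D / (n : ℝ)) / m) : ℂ)‖ ≤ Bξ := by
      intro hTn r hr
      have hrn : n / r * r = n := Nat.div_mul_cancel (Nat.dvd_of_mem_divisors hr)
      have hd1 : 1 ≤ n / r := Nat.div_pos (Nat.divisor_le hr) (Nat.pos_of_mem_divisors hr)
      have hr1 : 1 ≤ r := Nat.pos_of_mem_divisors hr
      have hxT : Skeleton.P1 D / (n : ℝ) ≤ bigT D := by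
        rw [div_le_iff₀ hnpos, hP1eq]; exact hTn
      have hdrP1 : ((n / r * r : ℕ) : ℝ) < Skeleton.P1 D := by rw [hrn, hP1eq]; exact hhi
      have hcr := Sj1321Outer.norm_sum84_le_log_mul c' χ j 6 (n / r) r hx1
      have hξx := hξ' (n / r) r hd1 hr1 hdrP1 _ hx1 hxT
      have hx0 : 0 < Skeleton.P1 D / (n : ℝ) := by linarith
      have hlogx0 : 0 ≤ Real.log (Skeleton.P1 D / (n : ℝ)) := Real.log_nonneg hx1
      have hlogx : Real.log (Skeleton.P1 D / (n : ℝ)) ≤ t := by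
        rw [← hlogT]; exact Real.log_le_log hx0 hxT
      calc _ ≤ Real.log (Skeleton.P1 D / (n : ℝ)) *
            ∑ m ∈ Finset.Ico 1 ⌈Skeleton.P1 D / (n : ℝ)⌉₊, ‖xiZero c' D j m (n / r) r‖ / m := hcr
        _ ≤ t * (Cξp * ell D * (1 + Real.log (Skeleton.P1 D / (n : ℝ))) ^ 3) :=
            mul_le_mul hlogx hξx (Finset.sum_nonneg fun m _ => by positivity) (by linarith)
        _ ≤ t * (Cξp * ell D * (1 + t) ^ 3) := by gcongr
        _ = Bξ := by rw [hBξ]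
    -- case analysis on the position of `n`
    by_cases hgn : good n
    · -- good: (10.4) × Lemma 8.4
      have hng1 : ¬ (¬ good n ∧ tail n) := fun h => h.1 hgn
      have hng2 : ¬ (¬ good n ∧ ¬ tail n) := fun h => h.1 hgn
      rw [if_pos hgn, if_neg hng1, if_neg hng2, mul_zero, mul_zero, add_zero, add_zero]
      have hyT : (n : ℝ) ≤ bigP D ^ (0.504 : ℝ) / bigT D := by
        rw [le_div_iff₀ hT0, mul_comm]; exact hgn.2.le
      have h1 : ‖mSum13 c' χ j n - 500 * deriv χ.LFunction 1 / Real.log (bigP D) *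
          (1 - betaJ c' D j * (Real.log (bigP D ^ (0.504 : ℝ) / n) : ℂ))‖ ≤
          |C₁| * (ell D ^ 15)⁻¹ := by
        rw [hMv]
        refine ((h₁' n).2.2.1 hgn.1 hyT).trans ?_
        exact mul_le_mul_of_nonneg_right (le_abs_self _) (by positivity)
      have := Sj1321Mid.norm_sum_divisors_le c' χ j hn0 (mSum13 c' χ j n) _ _ _ he₂0
        (by positivity) hlP1pos h1 hm₁ hg hL' hN (h2 hgn.2)
      refine this.trans (le_of_eq ?_)
      rw [hBg]; ring
    · by_cases htn : tail n
      · -- `T`-window: (10.5) × crude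
        have hc1 : ¬ good n ∧ tail n := ⟨hgn, htn⟩
        have hng2 : ¬ (¬ good n ∧ ¬ tail n) := fun h => h.2 htn
        rw [if_neg hgn, if_pos hc1, if_neg hng2, mul_zero, mul_zero, zero_add, add_zero]
        have hwin : (bigP D ^ (0.5 : ℝ) / bigT D < (n : ℝ) ∧ (n : ℝ) ≤ bigP D ^ (0.5 : ℝ)) ∨
            (bigP D ^ (0.502 : ℝ) / bigT D < (n : ℝ) ∧ (n : ℝ) ≤ bigP D ^ (0.502 : ℝ)) ∨
            (bigP D ^ (0.504 : ℝ) / bigT D < (n : ℝ) ∧ (n : ℝ) < bigP D ^ (0.504 : ℝ)) := by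
          right; right
          refine ⟨?_, hhi⟩
          rw [div_lt_iff₀ hT0, mul_comm]; exact htn
        have hM : ‖mSum13 c' χ j n‖ ≤ |C₁| * (ell D ^ 7)⁻¹ := by
          rw [hMv]
          exact ((h₁' n).2.2.2 hwin).trans
            (mul_le_mul_of_nonneg_right (le_abs_self _) (by positivity))
        have := norm_sum_divisors_le_crude c' χ j hn0 (mSum13 c' χ j n) _ _ _ hBξ0
          (by positivity) hlP1pos hM hm₁ hg hL' hN (hS htn.le)
        refine this.trans (le_of_eq ?_)
        rw [hBt]; ring
      · -- the two possible single points: `n = P^{0.502}` or `T·n = P₁`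
        have hc2 : ¬ good n ∧ ¬ tail n := ⟨hgn, htn⟩
        have hng1 : ¬ (¬ good n ∧ tail n) := fun h => htn h.2
        rw [if_neg hgn, if_neg hng1, if_pos hc2, mul_zero, mul_zero, zero_add, zero_add]
        rw [htail, not_lt] at htn
        rw [hgood, not_and_or] at hgn
        rcases hgn with hb | hb
        · -- `n = P^{0.502}`: (10.5) × Lemma 8.4
          have heq : (n : ℝ) = bigP D ^ (0.502 : ℝ) := le_antisymm (not_lt.mp hb) hlo
          have hTn : bigT D * (n : ℝ) < bigP D ^ (0.504 : ℝ) := by rw [heq]; exact hTP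
          have hwin : (bigP D ^ (0.5 : ℝ) / bigT D < (n : ℝ) ∧ (n : ℝ) ≤ bigP D ^ (0.5 : ℝ)) ∨
              (bigP D ^ (0.502 : ℝ) / bigT D < (n : ℝ) ∧ (n : ℝ) ≤ bigP D ^ (0.502 : ℝ)) ∨
              (bigP D ^ (0.504 : ℝ) / bigT D < (n : ℝ) ∧ (n : ℝ) < bigP D ^ (0.504 : ℝ)) := by
            right; left
            refine ⟨?_, le_of_eq heq⟩
            have : bigP D ^ (0.502 : ℝ) / bigT D < bigP D ^ (0.502 : ℝ) := div_lt_self hP2 hT1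
            linarith
          have hv : ‖frakv1 c' χ j (n : ℝ)‖ ≤ |C₁| * (ell D ^ 7)⁻¹ :=
            ((h₁' n).2.2.2 hwin).trans (mul_le_mul_of_nonneg_right (le_abs_self _) (by positivity))
          have h1 : ‖mSum13 c' χ j n - 500 * deriv χ.LFunction 1 / Real.log (bigP D) *
              (1 - betaJ c' D j * (Real.log (bigP D ^ (0.504 : ℝ) / n) : ℂ))‖ ≤
              |C₁| * (ell D ^ 7)⁻¹ + A := by
            rw [hMv]
            exact (norm_sub_le _ _).trans (add_le_add hv hm₁)
          have := Sj1321Mid.norm_sum_divisors_le c' χ j hn0 (mSum13 c' χ j n) _ _ _ he₂0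
            (by positivity) hlP1pos h1 hm₁ hg hL' hN (h2 hTn)
          refine this.trans ?_
          have e : ((n : ℝ) / Nat.totient n) ^ 7 / n *
              (((|C₁| * (ell D ^ 7)⁻¹ + A) * (e₂ + 146 * ell D ^ 3) + A * e₂) /
                Real.log (Skeleton.P1 D)) = Be * (((n : ℝ) / Nat.totient n) ^ 7 / n) := by
            rw [hBe]; ring
          rw [e]
          exact mul_le_mul_of_nonneg_right (le_add_of_nonneg_right hBp0) hw0
        · -- `T·n = P₁`: (10.4) × crude
          have hTn : bigT D * (n : ℝ) = bigP D ^ (0.504 : ℝ) := le_antisymm htn (not_lt.mp hb)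
          have hlo' : bigP D ^ (0.502 : ℝ) < (n : ℝ) := by
            by_contra hcon
            have heq : (n : ℝ) = bigP D ^ (0.502 : ℝ) := le_antisymm (not_lt.mp hcon) hlo
            rw [heq] at hTn
            exact (ne_of_lt hTP) hTn
          have hyT : (n : ℝ) ≤ bigP D ^ (0.504 : ℝ) / bigT D := by
            rw [le_div_iff₀ hT0, mul_comm]; exact hTn.le
          have h1' : ‖mSum13 c' χ j n - 500 * deriv χ.LFunction 1 / Real.log (bigP D) *
              (1 - betaJ c' D j * (Real.log (bigP D ^ (0.504 : ℝ) / n) : ℂ))‖ ≤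
              |C₁| * (ell D ^ 7)⁻¹ := by
            rw [hMv]
            refine ((h₁' n).2.2.1 hlo' hyT).trans ?_
            have h157 : (ell D ^ 15)⁻¹ ≤ (ell D ^ 7)⁻¹ :=
              inv_anti₀ (pow_pos hLpos 7) (pow_le_pow_right₀ hL1 (by norm_num))
            calc C₁ * (ell D ^ 15)⁻¹ ≤ |C₁| * (ell D ^ 15)⁻¹ :=
                  mul_le_mul_of_nonneg_right (le_abs_self _) (by positivity)
              _ ≤ |C₁| * (ell D ^ 7)⁻¹ := mul_le_mul_of_nonneg_left h157 (abs_nonneg _)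
          have hM : ‖mSum13 c' χ j n‖ ≤ |C₁| * (ell D ^ 7)⁻¹ + A := by
            have hins := norm_le_insert' (mSum13 c' χ j n)
              (500 * deriv χ.LFunction 1 / Real.log (bigP D) *
                (1 - betaJ c' D j * (Real.log (bigP D ^ (0.504 : ℝ) / n) : ℂ)))
            linarith only [hins, h1', hm₁]
          have := norm_sum_divisors_le_crude c' χ j hn0 (mSum13 c' χ j n) _ _ _ hBξ0
            (by positivity) hlP1pos hM hm₁ hg hL' hN (hS hTn.symm.le)
          refine this.trans ?_
          have e : ((n : ℝ) / Nat.totient n) ^ 7 / n *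
              (((|C₁| * (ell D ^ 7)⁻¹ + A) * Bξ + 146 * A * ell D ^ 3) /
                Real.log (Skeleton.P1 D)) = Bp * (((n : ℝ) / Nat.totient n) ^ 7 / n) := by
            rw [hBp]; ring
          rw [e]
          exact mul_le_mul_of_nonneg_right (le_add_of_nonneg_left hBe0) hw0
  -- **summation over the range**
  have hw0 : ∀ n : ℕ, 0 ≤ ((n : ℝ) / Nat.totient n) ^ 7 / n := fun n => by positivity
  -- weights of the three classes
  have hWg : ∑ n ∈ S, (if good n then ((n : ℝ) / Nat.totient n) ^ 7 / n else 0) ≤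
      Real.exp 256 * (2 + ell D ^ 9) := by
    rw [← Finset.sum_filter]
    refine le_trans (Finset.sum_le_sum_of_subset_of_nonneg ?_ fun n _ _ => hw0 n)
      (weight_good_top_le hL3)
    intro n hn
    rw [Finset.mem_filter] at hn
    obtain ⟨-, hg1, hg2⟩ := hn
    rw [Finset.mem_Ioc]
    refine ⟨(Nat.floor_lt hP2.le).mpr hg1, Nat.le_floor ?_⟩
    rw [le_div_iff₀ hT0, mul_comm]; exact hg2.le
  have hWt : ∑ n ∈ S, (if ¬ good n ∧ tail n then ((n : ℝ) / Nat.totient n) ^ 7 / n else 0) ≤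
      Real.exp 256 * (3 + t) := by
    rw [← Finset.sum_filter, ← hlogT]
    refine le_trans (Finset.sum_le_sum_of_subset_of_nonneg ?_ fun n _ _ => hw0 n)
      (weight_tail_top_le hL3)
    intro n hn
    rw [Finset.mem_filter, hSdef, Finset.mem_filter, Finset.mem_Ico] at hn
    obtain ⟨⟨⟨hn1, -⟩, hlo, hhi⟩, -, htn⟩ := hn
    rw [Finset.mem_Ioc]
    constructor
    · -- `⌈P₁/T⌉ − 1 < n` from `P₁/T < n`
      have h1 : bigP D ^ (0.504 : ℝ) / bigT D < (n : ℝ) := by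
        rw [div_lt_iff₀ hT0, mul_comm]; exact htn
      have h2 : ⌈bigP D ^ (0.504 : ℝ) / bigT D⌉₊ ≤ n := Nat.ceil_le.mpr h1.le
      omega
    · exact Nat.cast_le.mp ((hhi.le).trans (Nat.le_ceil _))
  have hWo : ∑ n ∈ S, (if ¬ good n ∧ ¬ tail n then ((n : ℝ) / Nat.totient n) ^ 7 / n else 0) ≤
      4 * Real.exp 256 := by
    rw [← Finset.sum_filter]
    have hlo2 : (1 : ℝ) < bigP D ^ (0.502 : ℝ) :=
      Real.one_lt_rpow (one_lt_bigP hLpos) (by norm_num)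
    set k₁ : ℕ := ⌈bigP D ^ (0.502 : ℝ)⌉₊ with hk₁
    set k₂ : ℕ := ⌈bigP D ^ (0.504 : ℝ) / bigT D⌉₊ with hk₂
    have hk₁2 : 2 ≤ k₁ := by
      have : 1 < k₁ := Nat.lt_ceil.mpr (by exact_mod_cast hlo2)
      omega
    have hy1 : (1 : ℝ) < bigP D ^ (0.504 : ℝ) / bigT D := by
      rw [lt_div_iff₀ hT0, one_mul]
      calc bigT D = bigT D * 1 := (mul_one _).symm
        _ < bigT D * bigP D ^ (0.502 : ℝ) := by gcongr
        _ < bigP D ^ (0.504 : ℝ) := hTP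
    have hk₂2 : 2 ≤ k₂ := by
      have : 1 < k₂ := Nat.lt_ceil.mpr (by exact_mod_cast hy1)
      omega
    set A₁ := Finset.Ioc (k₁ - 1) k₁ with hA₁
    set A₂ := Finset.Ioc (k₂ - 1) k₂ with hA₂
    have hsub : S.filter (fun n => ¬ good n ∧ ¬ tail n) ⊆ A₁ ∪ A₂ := by
      intro n hn
      rw [Finset.mem_filter, hSdef, Finset.mem_filter, Finset.mem_Ico] at hn
      obtain ⟨⟨⟨hn1, -⟩, hlo, hhi⟩, hng, hnt⟩ := hn
      rw [htail, not_lt] at hnt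
      rw [hgood, not_and_or] at hng
      rw [Finset.mem_union]
      rcases hng with h | h
      · left
        have heq : (n : ℝ) = bigP D ^ (0.502 : ℝ) := le_antisymm (not_lt.mp h) hlo
        have hkn : k₁ = n := by rw [hk₁, ← heq, Nat.ceil_natCast]
        rw [hA₁, Finset.mem_Ioc, hkn]
        omega
      · right
        have heq : bigT D * (n : ℝ) = bigP D ^ (0.504 : ℝ) := le_antisymm hnt (not_lt.mp h)
        have heq' : (n : ℝ) = bigP D ^ (0.504 : ℝ) / bigT D := by
          rw [eq_div_iff hT0.ne', mul_comm]; exact heq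
        have hkn : k₂ = n := by rw [hk₂, ← heq', Nat.ceil_natCast]
        rw [hA₂, Finset.mem_Ioc, hkn]
        omega
    have hAB := Finset.sum_union_inter (s₁ := A₁) (s₂ := A₂)
      (f := fun n : ℕ => ((n : ℝ) / Nat.totient n) ^ 7 / n)
    have hA1 := Sj1321Mid.weight_point_le hk₁2
    have hA2 := Sj1321Mid.weight_point_le hk₂2
    have hI : 0 ≤ ∑ n ∈ A₁ ∩ A₂, ((n : ℝ) / Nat.totient n) ^ 7 / n :=
      Finset.sum_nonneg fun n _ => hw0 n
    calc ∑ n ∈ S.filter (fun n => ¬ good n ∧ ¬ tail n), ((n : ℝ) / Nat.totient n) ^ 7 / n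
        ≤ ∑ n ∈ A₁ ∪ A₂, ((n : ℝ) / Nat.totient n) ^ 7 / n :=
          Finset.sum_le_sum_of_subset_of_nonneg hsub fun n _ _ => hw0 n
      _ ≤ ∑ n ∈ A₁, ((n : ℝ) / Nat.totient n) ^ 7 / n +
            ∑ n ∈ A₂, ((n : ℝ) / Nat.totient n) ^ 7 / n := by linarith
      _ ≤ 2 * Real.exp 256 + 2 * Real.exp 256 := add_le_add hA1 hA2
      _ = 4 * Real.exp 256 := by ring
  -- assemble
  calc ‖∑ n ∈ S, ∑ r ∈ n.divisors, drWeight c' χ j (n / r) r *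
          (mSum13 c' χ j n * nSum21 c' χ j (n / r) r -
            (500 * deriv χ.LFunction 1 / Real.log (bigP D) *
                (1 - betaJ c' D j * (Real.log (bigP D ^ (0.504 : ℝ) / n) : ℂ))) *
              (deriv χ.LFunction 1 * PiW χ (n / r) r *
                frakgW c' D j 6 (Skeleton.P1 D / (n : ℝ)) / (Real.log (Skeleton.P1 D) : ℂ)))‖
      ≤ ∑ n ∈ S, ‖∑ r ∈ n.divisors, drWeight c' χ j (n / r) r *
          (mSum13 c' χ j n * nSum21 c' χ j (n / r) r -
            (500 * deriv χ.LFunction 1 / Real.log (bigP D) *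
                (1 - betaJ c' D j * (Real.log (bigP D ^ (0.504 : ℝ) / n) : ℂ))) *
              (deriv χ.LFunction 1 * PiW χ (n / r) r *
                frakgW c' D j 6 (Skeleton.P1 D / (n : ℝ)) / (Real.log (Skeleton.P1 D) : ℂ)))‖ :=
        norm_sum_le _ _
    _ ≤ ∑ n ∈ S, (Bg * (if good n then ((n : ℝ) / Nat.totient n) ^ 7 / n else 0) +
          Bt * (if ¬ good n ∧ tail n then ((n : ℝ) / Nat.totient n) ^ 7 / n else 0) +
          (Be + Bp) * (if ¬ good n ∧ ¬ tail n then ((n : ℝ) / Nat.totient n) ^ 7 / n else 0)) :=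
        Finset.sum_le_sum key
    _ = Bg * ∑ n ∈ S, (if good n then ((n : ℝ) / Nat.totient n) ^ 7 / n else 0) +
          Bt * ∑ n ∈ S, (if ¬ good n ∧ tail n then ((n : ℝ) / Nat.totient n) ^ 7 / n else 0) +
          (Be + Bp) * ∑ n ∈ S,
            (if ¬ good n ∧ ¬ tail n then ((n : ℝ) / Nat.totient n) ^ 7 / n else 0) := by
        rw [Finset.sum_add_distrib, Finset.sum_add_distrib, Finset.mul_sum, Finset.mul_sum,
          Finset.mul_sum]
    _ ≤ Bg * (Real.exp 256 * (2 + ell D ^ 9)) + Bt * (Real.exp 256 * (3 + t)) +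
          (Be + Bp) * (4 * Real.exp 256) := by
        gcongr
    _ = Bg * (Real.exp 256 * (2 + ell D ^ 9)) + Bt * (Real.exp 256 * (3 + t)) +
          Be * (4 * Real.exp 256) + Bp * (4 * Real.exp 256) := by ring
    _ ≤ 4 * Real.exp 256 * Kg / (s * ell D ^ 9) +
          Real.exp 256 * (64 * |C₁| * Cξp + 1168000) / (s * ell D ^ 9) +
          8 * Real.exp 256 * Ke / (s * ell D ^ 9) +
          Real.exp 256 * (64 * (|C₁| + 1000) * Cξp + 1168000) / (s * ell D ^ 9) := by
        have hBg' : Bg * (Real.exp 256 * (2 + ell D ^ 9)) ≤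
            Kg * (ell D ^ 12)⁻¹ / (0.504 * ell D ^ 9) * (Real.exp 256 * (2 + ell D ^ 9)) := by
          have : Bg ≤ Kg * (ell D ^ 12)⁻¹ / (0.504 * ell D ^ 9) := by
            rw [hBg, hlP1]
            exact div_le_div_of_nonneg_right (Sj1321Mid.coeff_good_le hL1 C₁ C₂) (by positivity)
          exact mul_le_mul_of_nonneg_right this (by positivity)
        have hBe' : Be * (4 * Real.exp 256) ≤
            Ke * (ell D ^ 3)⁻¹ / (0.504 * ell D ^ 9) * (4 * Real.exp 256) := by
          have : Be ≤ Ke * (ell D ^ 3)⁻¹ / (0.504 * ell D ^ 9) := by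
            rw [hBe, hlP1]
            exact div_le_div_of_nonneg_right (Sj1321Mid.coeff_edge_le hL1 C₁ C₂) (by positivity)
          exact mul_le_mul_of_nonneg_right this (by positivity)
        have hT1 := term_good_le hL3 hKg0 hs1 hsL
        have hT2 := term_edge_le hL3 hKe0 hs1 hsL
        have hT3 := term_point_le (C₁ := C₁) hL3 hs1 hsL hs2 ht1 ht4 hCξ0
        have hT4 := term_tail_le (C₁ := C₁) hL3 hs1 hsL hs2 ht3 htL2 ht5 hCξ0
        rw [hBp, hBt, hlP1, hBξ, hAdef]
        linarith [hBg'.trans hT1, hBe'.trans hT2, hT3, hT4]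
    _ = Real.exp 256 * K / (s * ell D ^ 9) := by
        rw [hK]
        field_simp
        ring
    _ ≤ ε * (π / ell D ^ 9) := threshold_le hLpos hs0 hε hth
    _ = ε * alpha D := by rw [hα]

end Literature.NumberTheory.LFunctions.Zhang2022.Sj1321Top
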